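import Mathlib
import Literature.Analysis.Complex.RoucheTheorem

/-!
# `MatrixDescartes` — kit for the TWO-LETTER ROUCHÉ WINDOW LAW: sector discs, two-letter zero counts,
# zeros of polynomials in a disc with multiplicity

HONEST FRAMING.  Object-search cell `pub-symmetroid`, crux `Theses.LacunarySymmetroid.MatrixDescartes`
(ledger item `stmt-ValiantsHypothesis-18050`, route `LacunarySymmetroid`; seat `val-sym-mdr-p2`, gen 12).  The
crux implies `VP ≠ VNP` by the route's assembly; NOTHING here is progress on it and nothing here is a claim
about `VP ≠ VNP`, `DoorA26` / `DoorA34` or the cell's registers.  This file is the generic kit (geometry of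
sector discs, root counting with multiplicity) for the window law of
`…LacunarySymmetroidMatrixDescartesRoucheWindow.lean`; every statement is elementary.

* §1 **Sector discs.**  A disc `|z − c| < r` with `0 < r < c` subtends the half-angle `arcsin (r/c)` at the
  origin (`sq_im_lt_of_mem_ball`: `c²(Im z)² < r²|z|²`); if moreover `r ≤ c·sin(π/g)` (`g ≥ 2`) it lies in
  the open sector `|arg z| < π/g` (`abs_arg_lt_of_mem_ball`), on which `z ↦ z^g` is injective
  (`pow_injOn_ball`, via Mathlib's `Complex.pow_cpow_nat_inv`).  For `g = 1` no angular condition is needed.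
* §2 **Two-letter pencils.**  For complex `m × m` matrices `A, B` and exponents `a < b` (gap `g = b − a`),
  `det (X^a • A + X^b • B) = (X^a)^m · p(X^g)` with `p = det (X • B + A)`, `deg p ≤ m`
  (`det_twoLetter_eq`, Mathlib `Polynomial.natDegree_det_X_add_C_le`); the roots of `p ∘ X^g` are the
  `g`-th roots of the roots of `p` (`roots_comp_X_pow`), and at most one `g`-th root of any number lies in a
  sector disc (`card_nthRoots_filter_ball_le_one`).  Hence a nonzero two-letter determinant has AT MOST `m`
  roots, counted with multiplicity, in any sector disc (`card_roots_twoLetter_filter_ball_le`) — the count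
  that Rouché's theorem transfers to a full pencil in the window law.
* §3 **Bookkeeping.**  Complexification / evaluation of lacunary determinants (`map_det_pencil`,
  `eval_det_pencil`, `eval_det_twoLetter`, `eval_map_ofReal`); for a nonzero complex polynomial the zeros in
  a disc counted by `∑ᶠ analyticOrderNatAt` (the currency of the tree's Rouché theorem
  `Literature.Analysis.Complex.Rouche.finsum_analyticOrderNatAt_eq_of_norm_sub_lt`) are the roots in the disc
  counted with multiplicity (`finsum_mem_ball_eq_card_roots_filter`; the order/multiplicity identity
  `analyticOrderNatAt_eval_eq_rootMultiplicity` is re-proved here because the tree's copy in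
  `Literature.Analysis.Complex.LaguerrePolyaStarDeriv` is private).

[folklore] Elementary complex analysis / algebra: Mathlib `Complex.pow_cpow_nat_inv`, `Complex.arg_of_re_nonneg`,
`IsPrimitiveRoot.nthRoots_nodup`, `Polynomial.C_leadingCoeff_mul_prod_multiset_X_sub_C`,
`IsAlgClosed.card_roots_eq_natDegree`, `analyticOrderAt_mul`.
-/

-- `Summit.ValiantsHypothesis.ValiantsHypothesis.…` repeats a component by the D-0017 layout
-- (single-conjunct summit), which the `dupNamespace` linter flags; the name is mandated.
set_option linter.dupNamespace false

namespace Summit.ValiantsHypothesis.ValiantsHypothesis.Theorems.LacunarySymmetroidMatrixDescartes.RoucheWindow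

open Polynomial Complex Metric Set
open scoped BigOperators Matrix Real

/-! ## §1 Geometry: a disc `|z − c| < r` with `r ≤ c·sin(π/g)` lies in the sector `|arg z| < π/g`,
on which `z ↦ z^g` is injective -/

/-- In the disc `|z − c| < r` with `0 < r < c` one has `c²·(Im z)² < r²·|z|²`: the disc subtends the
half-angle `arcsin (r/c)` at the origin. [folklore] -/
theorem sq_im_lt_of_mem_ball {c r : ℝ} (hr : 0 < r) (hrc : r < c) {z : ℂ}
    (hz : z ∈ ball (c : ℂ) r) : c ^ 2 * z.im ^ 2 < r ^ 2 * (z.re ^ 2 + z.im ^ 2) := by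
  rw [mem_ball, dist_eq_norm] at hz
  have h1 : (z.re - c) ^ 2 + z.im ^ 2 < r ^ 2 := by
    have hn : ‖z - (c : ℂ)‖ ^ 2 = (z.re - c) ^ 2 + z.im ^ 2 := by
      rw [Complex.sq_norm, Complex.normSq_apply]
      simp only [sub_re, ofReal_re, sub_im, ofReal_im, sub_zero]
      ring
    have h0 : 0 ≤ ‖z - (c : ℂ)‖ := norm_nonneg _
    nlinarith
  have hc : 0 < c := hr.trans hrc
  have hpos : 0 < c ^ 2 - r ^ 2 := by nlinarith
  have h2 : z.im ^ 2 < r ^ 2 - (z.re - c) ^ 2 := by linarith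
  have hA : (c ^ 2 - r ^ 2) * z.im ^ 2 < (c ^ 2 - r ^ 2) * (r ^ 2 - (z.re - c) ^ 2) :=
    mul_lt_mul_of_pos_left h2 hpos
  have hB : r ^ 2 * z.re ^ 2 - (c ^ 2 - r ^ 2) * (r ^ 2 - (z.re - c) ^ 2)
      = (c * z.re - (c ^ 2 - r ^ 2)) ^ 2 := by ring
  nlinarith [sq_nonneg (c * z.re - (c ^ 2 - r ^ 2))]

/-- Points of the disc `|z − c| < r`, `0 < r < c`, have positive real part. [folklore] -/
theorem re_pos_of_mem_ball {c r : ℝ} (hrc : r < c) {z : ℂ}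
    (hz : z ∈ ball (c : ℂ) r) : 0 < z.re := by
  rw [mem_ball, dist_eq_norm] at hz
  have h := (abs_re_le_norm (z - (c : ℂ))).trans_lt hz
  simp only [sub_re, ofReal_re] at h
  have := (abs_lt.1 h).1
  linarith

/-- In the disc `|z − c| < r` with `0 < r < c` and `r ≤ c·sin(π/g)` (`g ≥ 2`), the argument satisfies
`|arg z| < π/g`. [folklore] -/
theorem abs_arg_lt_of_mem_ball {c r : ℝ} {g : ℕ} (hg : 2 ≤ g) (hr : 0 < r) (hrc : r < c)
    (hrs : r ≤ c * Real.sin (π / g)) {z : ℂ} (hz : z ∈ ball (c : ℂ) r) :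
    |arg z| < π / g := by
  have hc : 0 < c := hr.trans hrc
  have hre : 0 < z.re := re_pos_of_mem_ball hrc hz
  have hz0 : z ≠ 0 := fun h => by rw [h] at hre; simp at hre
  have hnorm : 0 < ‖z‖ := norm_pos_iff.2 hz0
  have hg0 : (0 : ℝ) < g := by exact_mod_cast (show 0 < g by omega)
  have hpg : π / g ≤ π / 2 :=
    div_le_div_of_nonneg_left Real.pi_pos.le two_pos (by exact_mod_cast hg)
  have hpg0 : 0 < π / g := div_pos Real.pi_pos hg0
  -- `|Im z| / ‖z‖ < r / c ≤ sin (π/g)`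
  have hsq := sq_im_lt_of_mem_ball hr hrc hz
  have hnsq : ‖z‖ ^ 2 = z.re ^ 2 + z.im ^ 2 := by
    rw [Complex.sq_norm, Complex.normSq_apply]; ring
  have hlt : |z.im| * c < r * ‖z‖ := by
    have h1 : (|z.im| * c) ^ 2 < (r * ‖z‖) ^ 2 := by
      rw [mul_pow, mul_pow, sq_abs, hnsq]; linarith
    exact lt_of_pow_lt_pow_left₀ 2 (by positivity) h1
  have hratio : |z.im| / ‖z‖ < Real.sin (π / g) := by
    rw [div_lt_iff₀ hnorm]
    have h2 : r * ‖z‖ ≤ c * Real.sin (π / g) * ‖z‖ := mul_le_mul_of_nonneg_right hrs hnorm.le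
    nlinarith
  have hup : z.im / ‖z‖ < Real.sin (π / g) :=
    lt_of_le_of_lt (div_le_div_of_nonneg_right (le_abs_self _) hnorm.le) hratio
  have hlo : Real.sin (-(π / g)) < z.im / ‖z‖ := by
    rw [Real.sin_neg]
    have h1 : -|z.im| / ‖z‖ ≤ z.im / ‖z‖ := div_le_div_of_nonneg_right (neg_abs_le _) hnorm.le
    rw [neg_div] at h1
    linarith
  rw [arg_of_re_nonneg hre.le, abs_lt]
  constructor
  · exact (Real.lt_arcsin_iff_sin_lt' ⟨by linarith, by linarith⟩).2 hlo
  · exact (Real.arcsin_lt_iff_lt_sin' ⟨by linarith, hpg⟩).2 hup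

/-- **Injectivity of `z ↦ z^g` on a sector disc.**  If `0 < r < c` and (for `g ≥ 2`) `r ≤ c·sin(π/g)`,
then two points of the disc `|z − c| < r` with the same `g`-th power coincide. [folklore] -/
theorem pow_injOn_ball {c r : ℝ} {g : ℕ} (hg : 1 ≤ g) (hr : 0 < r) (hrc : r < c)
    (hrs : 2 ≤ g → r ≤ c * Real.sin (π / g)) :
    InjOn (fun z : ℂ => z ^ g) (ball (c : ℂ) r) := by
  intro z₁ h₁ z₂ h₂ he
  simp only at he
  have hg0 : g ≠ 0 := by omega
  have harg : ∀ z ∈ ball (c : ℂ) r, -(π / g) < arg z ∧ arg z ≤ π / g := by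
    intro z hz
    rcases Nat.lt_or_ge g 2 with hg1 | hg2
    · have hg1' : g = 1 := by omega
      subst hg1'
      simp only [Nat.cast_one, div_one]
      exact ⟨neg_pi_lt_arg z, arg_le_pi z⟩
    · have h := abs_lt.1 (abs_arg_lt_of_mem_ball hg2 hr hrc (hrs hg2) hz)
      exact ⟨h.1, h.2.le⟩
  obtain ⟨hl₁, hu₁⟩ := harg z₁ h₁
  obtain ⟨hl₂, hu₂⟩ := harg z₂ h₂
  rw [← pow_cpow_nat_inv hg0 hl₁ hu₁, ← pow_cpow_nat_inv hg0 hl₂ hu₂, he]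

/-- The origin is not in the disc `|z − c| < r` when `r ≤ c`. [folklore] -/
theorem zero_not_mem_ball {c r : ℝ} (hrc : r ≤ c) : (0 : ℂ) ∉ ball (c : ℂ) r := by
  rw [mem_ball, dist_eq_norm, zero_sub, norm_neg, Complex.norm_real, Real.norm_eq_abs, not_lt]
  exact hrc.trans (le_abs_self c)


/-! ## §2 Two-letter pencils: at most `m` zeros, with multiplicity, in a sector disc -/

open Classical in
/-- At most ONE `g`-th root of any complex number lies in a sector disc. [folklore] -/
theorem card_nthRoots_filter_ball_le_one {c r : ℝ} {g : ℕ} (hg : 1 ≤ g) (hr : 0 < r) (hrc : r < c)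
    (hrs : 2 ≤ g → r ≤ c * Real.sin (π / g)) (y : ℂ) :
    Multiset.card ((nthRoots g y).filter (fun z => z ∈ ball (c : ℂ) r)) ≤ 1 := by
  classical
  have hg0 : 0 < g := hg
  by_cases hy : y = 0
  · subst hy
    have h0 : (nthRoots g (0 : ℂ)).filter (fun z => z ∈ ball (c : ℂ) r) = 0 := by
      rw [Multiset.filter_eq_nil]
      intro z hz
      rw [mem_nthRoots hg0] at hz
      rw [pow_eq_zero_iff (by omega)] at hz
      rw [hz]
      exact zero_not_mem_ball hrc.le
    rw [h0]
    simp
  · have hnd : ((nthRoots g y).filter (fun z => z ∈ ball (c : ℂ) r)).Nodup :=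
      (IsPrimitiveRoot.nthRoots_nodup (Complex.isPrimitiveRoot_exp g (by omega)) hy).filter _
    rw [← Multiset.toFinset_card_of_nodup hnd]
    refine Finset.card_le_one.2 fun z₁ h₁ z₂ h₂ => ?_
    rw [Multiset.mem_toFinset, Multiset.mem_filter, mem_nthRoots hg0] at h₁ h₂
    exact pow_injOn_ball hg hr hrc hrs h₁.2 h₂.2 (h₁.1.trans h₂.1.symm)

/-- Roots of `p ∘ X^g` over `ℂ`: the `g`-th roots of the roots of `p`, with multiplicity. [folklore] -/
theorem roots_comp_X_pow {p : ℂ[X]} (hp : p ≠ 0) {g : ℕ} (hg : 1 ≤ g) :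
    (p.comp (X ^ g)).roots = p.roots.bind (fun y => nthRoots g y) := by
  have hroots : Multiset.card p.roots = p.natDegree := IsAlgClosed.card_roots_eq_natDegree
  have hfac := C_leadingCoeff_mul_prod_multiset_X_sub_C hroots
  have hlc : p.leadingCoeff ≠ 0 := leadingCoeff_ne_zero.2 hp
  have hcomp : p.comp (X ^ g) =
      C p.leadingCoeff * (p.roots.map fun y => (X : ℂ[X]) ^ g - C y).prod := by
    conv_lhs => rw [← hfac]
    rw [mul_comp, C_comp, multiset_prod_comp, Multiset.map_map]
    congr 2
    refine Multiset.map_congr rfl fun y _ => ?_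
    simp only [Function.comp_apply, sub_comp, X_comp, C_comp]
  rw [hcomp, roots_C_mul _ hlc, roots_multiset_prod]
  · rw [Multiset.bind_map]
    rfl
  · rw [Multiset.mem_map]
    rintro ⟨y, -, hy⟩
    exact X_pow_sub_C_ne_zero hg y hy

/-- The two-letter pencil `X^a • A + X^b • B` (`a < b`, `g = b − a`) has determinant
`(X^a)^m · p(X^g)` with `p = det (X • B + A)` of degree `≤ m`. [folklore] -/
theorem det_twoLetter_eq {m a b : ℕ} (hab : a < b) (A B : Matrix (Fin m) (Fin m) ℂ) :
    Matrix.det (((X : ℂ[X]) ^ a) • A.map C + ((X : ℂ[X]) ^ b) • B.map C) =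
      ((X : ℂ[X]) ^ a) ^ m * (Matrix.det ((X : ℂ[X]) • B.map C + A.map C)).comp (X ^ (b - a)) := by
  have hsplit : ((X : ℂ[X]) ^ a) • A.map C + ((X : ℂ[X]) ^ b) • B.map C =
      ((X : ℂ[X]) ^ a) • (A.map C + ((X : ℂ[X]) ^ (b - a)) • B.map C) := by
    rw [smul_add, smul_smul, ← pow_add, Nat.add_sub_cancel' hab.le]
  have hmap : A.map C + ((X : ℂ[X]) ^ (b - a)) • B.map C =
      (compRingHom ((X : ℂ[X]) ^ (b - a))).mapMatrix ((X : ℂ[X]) • B.map C + A.map C) := by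
    ext i j
    simp only [RingHom.mapMatrix_apply, Matrix.map_apply, Matrix.add_apply, Matrix.smul_apply, smul_eq_mul,
      coe_compRingHom_apply, add_comp, mul_comp, X_comp, C_comp]
    ring
  rw [hsplit, Matrix.det_smul, Fintype.card_fin, hmap, ← RingHom.map_det, coe_compRingHom_apply]

open Classical in
/-- **Two-letter count.**  For complex `m × m` matrices `A, B`, exponents `a < b` with gap `g = b − a`,
and a disc `|z − c| < r` with `0 < r < c` and (when `g ≥ 2`) `r ≤ c·sin(π/g)`: if the two-letter
determinant `G = det (X^a • A + X^b • B)` is not the zero polynomial, it has at most `m` roots in the disc,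
counted with multiplicity.  (`G = X^(am)·p(X^g)` with `deg p ≤ m`; `0` is outside the disc and `z ↦ z^g`
is injective on it.) [folklore] -/
theorem card_roots_twoLetter_filter_ball_le {m a b : ℕ} (hab : a < b) (A B : Matrix (Fin m) (Fin m) ℂ)
    {c r : ℝ} (hr : 0 < r) (hrc : r < c) (hrs : 2 ≤ b - a → r ≤ c * Real.sin (π / (b - a : ℕ)))
    (hG : Matrix.det (((X : ℂ[X]) ^ a) • A.map C + ((X : ℂ[X]) ^ b) • B.map C) ≠ 0) :
    Multiset.card ((Matrix.det (((X : ℂ[X]) ^ a) • A.map C + ((X : ℂ[X]) ^ b) • B.map C)).roots.filter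
      (fun z => z ∈ ball (c : ℂ) r)) ≤ m := by
  classical
  have hg : 1 ≤ b - a := by omega
  set p : ℂ[X] := Matrix.det ((X : ℂ[X]) • B.map C + A.map C) with hp_def
  rw [det_twoLetter_eq hab] at hG ⊢
  have hq : p.comp (X ^ (b - a)) ≠ 0 := right_ne_zero_of_mul hG
  have hp : p ≠ 0 := fun h => hq (by rw [h, zero_comp])
  have hXa : ((X : ℂ[X]) ^ a) ^ m ≠ 0 := left_ne_zero_of_mul hG
  rw [roots_mul hG, Multiset.filter_add, Multiset.card_add]
  -- the factor `(X^a)^m` has all its roots at `0`, outside the disc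
  have h0 : Multiset.card ((((X : ℂ[X]) ^ a) ^ m).roots.filter (fun z => z ∈ ball (c : ℂ) r)) = 0 := by
    rw [Multiset.card_eq_zero, Multiset.filter_eq_nil]
    intro z hz
    rw [roots_pow, roots_pow, roots_X] at hz
    have hz0 : z = 0 := by
      have := Multiset.mem_of_mem_nsmul (Multiset.mem_of_mem_nsmul hz)
      rwa [Multiset.mem_singleton] at this
    rw [hz0]
    exact zero_not_mem_ball hrc.le
  rw [h0, zero_add, roots_comp_X_pow hp hg, Multiset.filter_bind, Multiset.card_bind]
  calc (Multiset.map (fun y => Multiset.card (Multiset.filter (fun z => z ∈ ball (c : ℂ) r) (nthRoots (b - a) y)))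
          p.roots).sum
      ≤ Multiset.card (Multiset.map (fun y => Multiset.card
          (Multiset.filter (fun z => z ∈ ball (c : ℂ) r) (nthRoots (b - a) y))) p.roots) • 1 := by
        refine Multiset.sum_le_card_nsmul _ _ fun x hx => ?_
        obtain ⟨y, -, rfl⟩ := Multiset.mem_map.1 hx
        exact card_nthRoots_filter_ball_le_one hg hr hrc hrs y
    _ = Multiset.card p.roots := by rw [Multiset.card_map, smul_eq_mul, mul_one]
    _ ≤ p.natDegree := card_roots' p
    _ ≤ m := by
        have h := natDegree_det_X_add_C_le B A
        rwa [Fintype.card_fin] at h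


/-! ## §3 Polynomial bookkeeping: complexification, evaluation, zeros with multiplicity in a disc -/

/-- Complexification of the determinant of a real lacunary pencil. [folklore] -/
theorem map_det_pencil {K m : ℕ} (d : Fin K → ℕ) (S : Fin K → Matrix (Fin m) (Fin m) ℝ) :
    (Matrix.det (∑ l, ((X : ℝ[X]) ^ d l) • (S l).map C)).map (algebraMap ℝ ℂ) =
      Matrix.det (∑ l, ((X : ℂ[X]) ^ d l) • ((S l).map (algebraMap ℝ ℂ)).map C) := by
  change mapRingHom (algebraMap ℝ ℂ) _ = _
  rw [RingHom.map_det]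
  congr 1
  ext i j
  simp [Matrix.sum_apply, Matrix.smul_apply, Matrix.map_apply]

/-- Evaluation of the determinant of a complex lacunary pencil at a complex point. [folklore] -/
theorem eval_det_pencil {K m : ℕ} (d : Fin K → ℕ) (T : Fin K → Matrix (Fin m) (Fin m) ℂ) (z : ℂ) :
    (Matrix.det (∑ l, ((X : ℂ[X]) ^ d l) • (T l).map C)).eval z = Matrix.det (∑ l, (z ^ d l) • T l) := by
  rw [← Polynomial.coe_evalRingHom, RingHom.map_det]
  congr 1
  ext i j
  simp [Matrix.sum_apply, Matrix.smul_apply, Matrix.map_apply]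
  exact Finset.sum_congr rfl fun _ _ => mul_comm _ _

/-- Evaluation of a two-letter determinant at a complex point. [folklore] -/
theorem eval_det_twoLetter {m a b : ℕ} (A B : Matrix (Fin m) (Fin m) ℂ) (z : ℂ) :
    (Matrix.det (((X : ℂ[X]) ^ a) • A.map C + ((X : ℂ[X]) ^ b) • B.map C)).eval z =
      Matrix.det ((z ^ a) • A + (z ^ b) • B) := by
  rw [← Polynomial.coe_evalRingHom, RingHom.map_det]
  congr 1
  ext i j
  simp [Matrix.add_apply, Matrix.smul_apply, Matrix.map_apply]
  ring

/-- Evaluating the complexification of a real polynomial at a real point. [folklore] -/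
theorem eval_map_ofReal (f : ℝ[X]) (x : ℝ) :
    (f.map (algebraMap ℝ ℂ)).eval (x : ℂ) = ((f.eval x : ℝ) : ℂ) := by
  rw [eval_map, ← aeval_def, show (x : ℂ) = algebraMap ℝ ℂ x from rfl,
    aeval_algebraMap_apply_eq_algebraMap_eval]
  rfl

/-- Order of vanishing of a nonzero complex polynomial function is the root multiplicity
(as in `Literature.Analysis.Complex.LaguerrePolyaStarDeriv`, where it is private). [folklore] -/
theorem analyticOrderNatAt_eval_eq_rootMultiplicity {D : ℂ[X]} (hD : D ≠ 0) (w : ℂ) :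
    analyticOrderNatAt (fun z => D.eval z) w = D.rootMultiplicity w := by
  set n := D.rootMultiplicity w with hn
  set q := D /ₘ (X - C w) ^ n with hq
  have hdec : (X - C w) ^ n * q = D := D.pow_mul_divByMonic_rootMultiplicity_eq w
  have hqw : q.eval w ≠ 0 := eval_divByMonic_pow_rootMultiplicity_ne_zero w hD
  have hfun : (fun z => D.eval z) = ((· - w) ^ n) * fun z => q.eval z := by
    funext z
    conv_lhs => rw [← hdec]
    simp [eval_pow]
  have h1 : AnalyticAt ℂ ((· - w) ^ n) w := by fun_prop
  have h2 : AnalyticAt ℂ (fun z => q.eval z) w := (AnalyticOnNhd.eval_polynomial q) w (Set.mem_univ _)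
  rw [analyticOrderNatAt, hfun, analyticOrderAt_mul h1 h2, analyticOrderAt_centeredMonomial,
    h2.analyticOrderAt_eq_zero.mpr hqw, add_zero, ENat.toNat_coe]

open Classical in
/-- The zeros of a nonzero complex polynomial in an open disc, counted with multiplicity
(`∑ᶠ analyticOrderNatAt`), equal the number of its roots in the disc counted with multiplicity. [folklore] -/
theorem finsum_mem_ball_eq_card_roots_filter {D : ℂ[X]} (hD : D ≠ 0) (c : ℂ) (r : ℝ) :
    ∑ᶠ z ∈ ball c r, analyticOrderNatAt (fun w => D.eval w) z =
      Multiset.card (D.roots.filter (fun z => z ∈ ball c r)) := by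
  classical
  have hsupp : Function.support (fun z => analyticOrderNatAt (fun w => D.eval w) z) ⊆
      (D.roots.toFinset : Set ℂ) := by
    intro z hz
    rw [Function.mem_support, analyticOrderNatAt_eval_eq_rootMultiplicity hD] at hz
    have hz' : 0 < D.rootMultiplicity z := Nat.pos_of_ne_zero hz
    rw [rootMultiplicity_pos hD] at hz'
    simpa [Multiset.mem_toFinset, mem_roots hD] using hz' 
  rw [finsum_mem_eq_sum_of_inter_support_eq (fun z => analyticOrderNatAt (fun w => D.eval w) z)
    (t := D.roots.toFinset.filter (fun z => z ∈ ball c r)) ?_]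
  · rw [← Multiset.toFinset_sum_count_eq, Multiset.toFinset_filter]
    refine Finset.sum_congr rfl fun z hz => ?_
    rw [Finset.mem_filter] at hz
    rw [analyticOrderNatAt_eval_eq_rootMultiplicity hD, Multiset.count_filter, if_pos hz.2, count_roots]
  · ext z
    simp only [mem_inter_iff, Function.mem_support, ne_eq, Finset.coe_filter, mem_setOf_eq]
    constructor
    · rintro ⟨hz, hne⟩
      exact ⟨⟨hsupp (Function.mem_support.2 hne), hz⟩, hne⟩
    · rintro ⟨⟨-, hz⟩, hne⟩
      exact ⟨hz, hne⟩

open Classical in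
/-- Distinct roots in a disc are at most the roots counted with multiplicity. [folklore] -/
theorem card_roots_toFinset_filter_le {D : ℂ[X]} (c : ℂ) (r : ℝ) :
    (D.roots.toFinset.filter (fun z => z ∈ ball c r)).card ≤
      Multiset.card (D.roots.filter (fun z => z ∈ ball c r)) := by
  rw [← Multiset.toFinset_filter]
  exact Multiset.toFinset_card_le _

end Summit.ValiantsHypothesis.ValiantsHypothesis.Theorems.LacunarySymmetroidMatrixDescartes.RoucheWindow
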